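import Literature.NumberTheory.Automorphic.PairLFunctionPolesEqConjArch
import Literature.NumberTheory.Automorphic.WhittakerArchFinFactorization
import HarnessLib

/-!
# The spread projectors act on the finite component: `E_L (T̂ x) = T̂_L x` for an intertwiner `T_L ∈ M`

Topic `NumberTheory/Automorphic`; namespace `Literature.NumberTheory.Automorphic`. Theorems only.

Let `Π ≤ L²_cusp` have archimedean component `τ` on `E` and smooth multiplicity module
`M = ⋃_{U₀} Hom_{G_∞}(τ, Π^{U₀}) ≅ π_f` (`CuspidalRepFiniteComponent`). The iterated spread projectors
`E_L = E_{v₁} ∘ ⋯ ∘ E_{v_r}` of `PairLFunctionPolesEqConjArch` (twisted averages over the compact open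
groups `ι_v(H_v)` at finitely many finite places, `spreadIter`) are FINITE-adelic operators: they are
bounded, linear, commute with `G_∞` and lower the level in a controlled way. Hence for `T ∈ M` of
level `K_f(𝔫₁)` there is `T_L ∈ M`, of level `K_f(𝔫_L)` (`𝔫_L = 𝔫₁ ∏_{v ∈ L} 𝔭_v^{k_v}`), with

  `T̂_L x = E_L (T̂ x)`   for all `x ∈ E`

(`exists_spreadIter_intertwiner`): the spread vector of `x ⊗ T` is `x ⊗ (E_L T)`, with the SAME
archimedean component `x`. Consequences recorded here: the vectors `T̂_L x` are `(H_v, χ_v)`-isotypic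
at every `v ∈ L` (`isotypic_apply_of_spreadIter_intertwiner`), and the `ψ_f`-Whittaker coordinate is
unchanged, `Λ₀(T_L) = Λ₀(T)`, for the factorisation `Φ_ℓ(T) = Λ₀(T) • ℓ_∞` of
`WhittakerArchFinFactorization` (`finWhittaker_spreadIter_intertwiner_eq`; from
`whittakerFunctional_spreadIter`, the invariance of the Whittaker functional under `E_L`). This is
the finite-place half of the realisation of an archimedean Rankin–Selberg datum by global vectors
with prescribed archimedean components (Jacquet–Piatetski-Shapiro–Shalika (1983), (2.7);
Jacquet–Shalika (1981), §4, (5.1): the test vectors at the bad finite places).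

## References

* H. Jacquet, I. I. Piatetski-Shapiro, J. A. Shalika, *Rankin–Selberg convolutions*, Amer. J. Math.
  105 (1983), §2, (2.7) [JacquetPiatetskiShapiroShalika1983].
* H. Jacquet, J. A. Shalika, *On Euler products and the classification of automorphic
  representations I*, Amer. J. Math. 103 (1981), §4, (5.1) [JacquetShalikaAJM1981].
-/

noncomputable section

open MeasureTheory Measure NumberField NumberField.mixedEmbedding IsDedekindDomain Matrix WithZero Set Filter
open scoped MatrixGroups ComplexConjugate Topology NNReal Classical
open Literature.NumberTheory.Automorphic.WhittakerSupport

namespace Literature.NumberTheory.Automorphic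

section Intertwiner

variable {n : ℕ} {K : Type} [Field K] [NumberField K]
variable {μ : Measure (AdelicGroupData.gl n K).automorphicQuotient} [(AdelicGroupData.gl n K).IsAutomorphicMeasure μ]

-- the house Borel structures, as in `PairLFunctionPolesEqConjArch` (section `Iter`)
attribute [local instance] adelicBorel borelSpace_adelic locallyCompactSpace_adelic secondCountableTopology_gl_adelic
  glAdeleBorel borelSpace_glAdele
attribute [local instance] glLocalBorel borelSpace_glLocal

variable {hcpt : isCompact_glFiniteIntegralLevel n K}
  {E : Type*} [NormedAddCommGroup E] [InnerProductSpace ℂ E] [CompleteSpace E]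
  {τ : ContRepresentation ℂ (AutomorphyDatum.gl n K hcpt).arch.carrier E}
  {W : ContRepresentation.ClosedSubrep ((AdelicGroupData.gl n K).rightRegular μ)}
  {c e : HeightOneSpectrum (𝓞 K) → ℤ} {ϖ : ∀ v : HeightOneSpectrum (𝓞 K), (v.adicCompletion K)ˣ}

/-- `E_L` is additive. [folklore] -/
theorem spreadIter_add {L : List (HeightOneSpectrum (𝓞 K))} (hL : ∀ v ∈ L, SpreadHyp c e ϖ v)
    (x y : W.toSubmodule) :
    spreadIter W c e ϖ L (x + y) = spreadIter W c e ϖ L x + spreadIter W c e ϖ L y := by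
  induction L with
  | nil => rfl
  | cons v L ih =>
    rw [spreadIter_cons, spreadIter_cons, spreadIter_cons, ih (fun w hw => hL w (List.mem_cons_of_mem _ hw)),
      spreadE, spreadProjector_add (hL v List.mem_cons_self).hψ]
    rfl

/-- `‖E_L x‖ ≤ ‖x‖`. [folklore] -/
theorem norm_spreadIter_le {L : List (HeightOneSpectrum (𝓞 K))} (hL : ∀ v ∈ L, SpreadHyp c e ϖ v)
    (x : W.toSubmodule) : ‖spreadIter W c e ϖ L x‖ ≤ ‖x‖ := by
  induction L with
  | nil => exact le_rfl
  | cons v L ih =>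
    rw [spreadIter_cons, spreadE]
    exact (norm_spreadProjector_le (hL v List.mem_cons_self).hψ _).trans
      (ih fun w hw => hL w (List.mem_cons_of_mem _ hw))

/-- An element of `K(𝔫)` is `(1, u)` with `u ∈ K_f(𝔫)`. [folklore] -/
theorem eq_ofFinite_sndHom_of_mem_principalCongruenceLevel {𝔫 : Ideal (𝓞 K)}
    {g : GL (Fin n) (AdeleRing (𝓞 K) K)} (hg : g ∈ principalCongruenceLevel n K 𝔫) :
    g = GLn.ofFinite n K (GLn.sndHom n K g) ∧ GLn.sndHom n K g ∈ finitePrincipalCongruenceLevel n K 𝔫 := by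
  have h1 : GLn.ofFinite n K (GLn.sndHom n K g) = g :=
    GLn.ofFinite_sndHom_of_mem (principalCongruenceLevel_le n K 𝔫 hg)
  refine ⟨h1.symm, ?_⟩
  rw [mem_finitePrincipalCongruenceLevel_iff, h1]
  exact hg

omit [CompleteSpace E] in
/-- **The spread projectors act on the finite component.** For `T ∈ M` of level `K_f(𝔫₁)`
(`𝔫₁ ≠ 0`), spread data `(c, e, ϖ)` satisfying `SpreadHyp` at the places of a list `L` without
repetition, there is `T_L ∈ M` of level `K_f(𝔫_L)`, `𝔫_L = spreadLevelIdeal 𝔫₁ k L`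
(`k_v = 2 n (M_v - c_v)`), with `T̂_L x = E_L (T̂ x)` for all `x ∈ E`: `E_L` is bounded linear
(`spreadIter_add`, `spreadIter_smul`, `norm_spreadIter_le`), commutes with `G_∞`
(`toContRep_spreadIter`, the elements `(h, 1)` having trivial components at the places of `L`) and
lowers the level as stated (`toContRep_spreadIter_of_mem_principalCongruenceLevel`).
[cite: JacquetPiatetskiShapiroShalika1983, §2 (2.7)] -/
theorem exists_spreadIter_intertwiner {𝔫₁ : Ideal (𝓞 K)} (h𝔫₁ : 𝔫₁ ≠ 0)
    {L : List (HeightOneSpectrum (𝓞 K))} (hL : ∀ v ∈ L, SpreadHyp c e ϖ v) (hnd : L.Nodup)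
    {T : E →L[ℂ] (AdelicGroupData.gl n K).L2 μ}
    (hT : T ∈ archIntertwinersLevel hcpt τ W (finitePrincipalCongruenceLevel n K 𝔫₁)) :
    ∃ TL : E →L[ℂ] (AdelicGroupData.gl n K).L2 μ,
      TL ∈ archIntertwinersLevel hcpt τ W
        (finitePrincipalCongruenceLevel n K (spreadLevelIdeal 𝔫₁ (fun v => spreadK n (c v) (e v)) L)) ∧
      ∀ x : E, TL x = ((spreadIter W c e ϖ L (corestrictW hT.1 x) : W.toSubmodule) : (AdelicGroupData.gl n K).L2 μ) := by
  -- `E_L` as a bounded operator on `W`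
  set EL : W.toSubmodule →L[ℂ] W.toSubmodule :=
    LinearMap.mkContinuous
      { toFun := spreadIter W c e ϖ L
        map_add' := spreadIter_add hL
        map_smul' := fun a x => spreadIter_smul L a x } 1
      (fun x => by rw [one_mul]; exact norm_spreadIter_le hL x) with hEL
  have hELa : ∀ x : W.toSubmodule, EL x = spreadIter W c e ϖ L x := fun x => rfl
  set TL : E →L[ℂ] (AdelicGroupData.gl n K).L2 μ := W.toSubmodule.subtypeL ∘L (EL ∘L corestrictW hT.1) with hTL
  have hTLa : ∀ x : E, TL x =
      ((spreadIter W c e ϖ L (corestrictW hT.1 x) : W.toSubmodule) : (AdelicGroupData.gl n K).L2 μ) := fun x => rfl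
  -- level of `T̂ x`
  have hfix : ∀ x : E, ∀ g ∈ principalCongruenceLevel n K 𝔫₁, W.toContRep g (corestrictW hT.1 x) = corestrictW hT.1 x := by
    intro x g hg
    obtain ⟨hgeq, hu⟩ := eq_ofFinite_sndHom_of_mem_principalCongruenceLevel hg
    apply Subtype.ext
    rw [ContRepresentation.ClosedSubrep.coe_toContRep_apply, coe_corestrictW_apply, hgeq]
    exact (mem_levelPiece_iff.1 (hT.2 x)).2 _ hu
  refine ⟨TL, ⟨⟨fun x => ?_, fun h x => ?_⟩, fun x => ?_⟩, hTLa⟩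
  · -- values in `W`
    rw [hTLa]
    exact (spreadIter W c e ϖ L (corestrictW hT.1 x)).2
  · -- intertwining with `G_∞`
    rw [hTLa, hTLa, archRegular_apply]
    have hh : (AutomorphyDatum.gl n K hcpt).ofArch h = GLn.ofInfinite n K (h : GL (Fin n) (mixedSpace K)) := rfl
    have h1 : corestrictW hT.1 (τ h x) = W.toContRep (GLn.ofInfinite n K (h : GL (Fin n) (mixedSpace K))) (corestrictW hT.1 x) :=
      corestrictW_apply_apply hT.1 (h : GL (Fin n) (mixedSpace K)) x
    rw [h1, ← toContRep_spreadIter hL (fun v _ => localComponent_ofInfinite _), hh,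
      ContRepresentation.ClosedSubrep.coe_toContRep_apply]
  · -- level `K_f(𝔫_L)`
    rw [mem_levelPiece_iff]
    refine ⟨by rw [hTLa]; exact (spreadIter W c e ϖ L (corestrictW hT.1 x)).2, fun u hu => ?_⟩
    rw [hTLa, ← ContRepresentation.ClosedSubrep.coe_toContRep_apply,
      toContRep_spreadIter_of_mem_principalCongruenceLevel h𝔫₁ hL hnd (hfix x) _
        (mem_finitePrincipalCongruenceLevel_iff.1 hu)]

omit [CompleteSpace E] in
/-- **The spread vectors `T̂_L x` are `(H_v, χ_v)`-isotypic at every place of `L`.** [folklore] -/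
theorem isotypic_apply_of_spreadIter_intertwiner
    {L : List (HeightOneSpectrum (𝓞 K))} (hL : ∀ v ∈ L, SpreadHyp c e ϖ v) (hnd : L.Nodup)
    {T : E →L[ℂ] (AdelicGroupData.gl n K).L2 μ} (hT : T ∈ archIntertwiners hcpt τ W)
    {TL : E →L[ℂ] (AdelicGroupData.gl n K).L2 μ} (hTL : TL ∈ archIntertwiners hcpt τ W)
    (hTLeq : ∀ x : E, TL x = ((spreadIter W c e ϖ L (corestrictW hT x) : W.toSubmodule) : (AdelicGroupData.gl n K).L2 μ))
    (x : E) :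
    ∀ v ∈ L, ∀ h ∈ spreadLevelGroup (spreadTorus n (ϖ v) (c v) (e v)) (spreadM (c v) (e v)),
      W.toContRep (GLn.ofLocal n K v h) (corestrictW hTL x) = spreadChar v h • corestrictW hTL x := by
  intro v hv h hh
  have hvec : corestrictW hTL x = spreadIter W c e ϖ L (corestrictW hT x) := Subtype.ext (hTLeq x)
  rw [hvec]
  exact isotypic_spreadIter hL hnd (corestrictW hT x) v hv h hh

/-- **`E_L` preserves the `ψ_f`-Whittaker coordinate: `Λ₀(T_L) = Λ₀(T)`.** For the factorisation
`Φ_ℓ(T) = Λ₀(T) • ℓ_∞` of the transfer map of the Whittaker functional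
(`exists_finWhittaker_transferMap_eq_smul`, with `ℓ_∞ = Φ_ℓ(T₀) ≠ 0`), a spread intertwiner
`T̂_L = E_L ∘ T̂` of `T ∈ M` of level `K_f(𝔫₁)` (with `exp(-e_v) ≤ |𝔫₁|_v` on `L`) has the same
coordinate as `T`: `ℓ(E_L y) = ℓ(y)` for level-`K(𝔫₁)` Gårding vectors `y`
(`whittakerFunctional_spreadIter`). [cite: JacquetShalikaAJM1981, §4 (5.1)] -/
theorem finWhittaker_spreadIter_intertwiner_eq (hτ : τ.IsStronglyContinuous)
    (ν₀ : Measure ↥(adelicUnipotent n K)) [IsHaarMeasure ν₀]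
    {𝔫₁ : Ideal (𝓞 K)} (h𝔫₁ : 𝔫₁ ≠ 0)
    {L : List (HeightOneSpectrum (𝓞 K))} (hL : ∀ v ∈ L, SpreadHyp c e ϖ v) (hnd : L.Nodup)
    (hrad : ∀ v ∈ L, exp (-e v) ≤ idealRadius K v 𝔫₁)
    {T₀ : multiplicityModule hcpt τ W} {Λ₀ : multiplicityModule hcpt τ W →ₗ[ℂ] ℂ}
    (hne : transferMap (whittakerFunctional ν₀ (continuous_adeleAddChar K)
      (ContRepresentation.Equiv.refl W.toContRep)) hτ T₀ ≠ 0)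
    (hΛ : ∀ T : multiplicityModule hcpt τ W,
      transferMap (whittakerFunctional ν₀ (continuous_adeleAddChar K)
        (ContRepresentation.Equiv.refl W.toContRep)) hτ T =
        Λ₀ T • transferMap (whittakerFunctional ν₀ (continuous_adeleAddChar K)
          (ContRepresentation.Equiv.refl W.toContRep)) hτ T₀)
    (T TL : multiplicityModule hcpt τ W)
    (hT : (T : E →L[ℂ] (AdelicGroupData.gl n K).L2 μ) ∈
      archIntertwinersLevel hcpt τ W (finitePrincipalCongruenceLevel n K 𝔫₁))
    (hTLeq : ∀ x : E, (TL : E →L[ℂ] (AdelicGroupData.gl n K).L2 μ) x =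
      ((spreadIter W c e ϖ L (corestrictW hT.1 x) : W.toSubmodule) : (AdelicGroupData.gl n K).L2 μ)) :
    Λ₀ TL = Λ₀ T := by
  set ℓ := whittakerFunctional ν₀ (continuous_adeleAddChar K) (ContRepresentation.Equiv.refl W.toContRep) with hℓ
  -- a Gårding vector `x₀` with `ℓ_∞ x₀ ≠ 0`
  obtain ⟨x₀, hx₀⟩ : ∃ x₀ : archGardingSpace hcpt τ, transferMap ℓ hτ T₀ x₀ ≠ 0 := by
    by_contra h
    push Not at h
    exact hne (LinearMap.ext fun v => h v)
  -- `ℓ(T̂_L x₀) = ℓ(E_L (T̂ x₀)) = ℓ(T̂ x₀)`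
  have hy : corestrictW hT.1 (x₀ : E) ∈ gardingSpace W :=
    gardingSubspace_le_gardingSpace _ (corestrictW_mem_gardingSubspace hT hτ
      (isOpen_finitePrincipalCongruenceLevel n K h𝔫₁) (isCompact_finitePrincipalCongruenceLevel n K h𝔫₁) x₀.2)
  have hfix : ∀ g ∈ principalCongruenceLevel n K 𝔫₁, W.toContRep g (corestrictW hT.1 (x₀ : E)) = corestrictW hT.1 (x₀ : E) := by
    intro g hg
    obtain ⟨hgeq, hu⟩ := eq_ofFinite_sndHom_of_mem_principalCongruenceLevel hg
    apply Subtype.ext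
    rw [ContRepresentation.ClosedSubrep.coe_toContRep_apply, coe_corestrictW_apply, hgeq]
    exact (mem_levelPiece_iff.1 (hT.2 (x₀ : E))).2 _ hu
  obtain ⟨hE, hℓE⟩ := whittakerFunctional_spreadIter ν₀ (W := W) (c := c) (e := e) (ϖ := ϖ) h𝔫₁ hL hnd hrad hy hfix
  -- read both sides through the transfer maps
  have h1 : transferMap ℓ hτ TL x₀ = ℓ ⟨spreadIter W c e ϖ L (corestrictW hT.1 (x₀ : E)), hE⟩ := by
    rw [transferMap_apply_apply]
    congr 1
    apply Subtype.ext
    exact Subtype.ext (hTLeq x₀)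
  have h2 : transferMap ℓ hτ T x₀ = ℓ ⟨corestrictW hT.1 (x₀ : E), hy⟩ := by
    rw [transferMap_apply_apply]
  have h3 : transferMap ℓ hτ TL x₀ = transferMap ℓ hτ T x₀ := by rw [h1, h2, hℓE]
  rw [hΛ TL, hΛ T, LinearMap.smul_apply, LinearMap.smul_apply, smul_eq_mul, smul_eq_mul] at h3
  exact mul_right_cancel₀ hx₀ h3

end Intertwiner

end Literature.NumberTheory.Automorphic
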